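import Mathlib
import Summits.NavierStokesRegularity.NavierStokesRegularity.Theorems.TaoLadderRungTwoBreakOneShiftWindowTermField
import HarnessLib

/-!
# The one-shift window system, XXI: term-list fields are SMOOTH, with an explicit derivative bound and a Lipschitz
# constant on every ball — the generic hypotheses `hfC` / `hf'` / `hloc` of the Literature C¹ enclosure theorem
# `hasFDerivWithinAt_flow_of_variationalEnclosure` for the flat centre field (cell harvest/h2-tao-ladder, seat p2;
# rung1/KERNEL-CHEAP-REPLAY-SPEC.md §7 (R2); support for K1(1) = `NoSurvivingDSSOne`, stmt-NavierStokesRegularity-20205)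

MODEL lattice ODEs only (Tao 2016 §4 normal form on Tao's shift set `S`); nothing here is a statement about
the Navier–Stokes equations; no item is closed; nothing numerical is proved. Generic in `ι`, `κ`.

* `contDiff_termField` — `termField T` is `C^∞` (finite sums of products of coordinates and constants);
* `abs_factor_val_le`, `norm_factor_deriv_le` — `|val φ x| ≤ max ‖x‖ |e|`-type bounds and `‖deriv φ‖ ≤ 1`;
* `norm_termFieldDeriv_le` — on the ball `‖x‖ ≤ ρ`: `‖termFieldDeriv T x‖ ≤ derivBound T ρ :=
  Σ_k |coef_k| (bnd fa_k ρ + bnd fb_k ρ)` (`bnd (coord _) ρ = ρ`, `bnd (ext e) ρ = |e|`);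
* `lipschitzOnWith_termField` — `termField T` is `derivBound T ρ`-Lipschitz on `closedBall 0 ρ` (mean value
  theorem on the convex ball); `exists_lipschitzOnWith_termField` — the `hloc` form.
-/

noncomputable section

-- the sub-problem namespace repeats the summit name by design (D-0017)
set_option linter.dupNamespace false

namespace Summit.NavierStokesRegularity.NavierStokesRegularity.Theorems

namespace DSSOneShift

open Set Metric
open scoped NNReal

variable {ι : Type*} [Fintype ι] [DecidableEq ι] {κ : Type*} [Fintype κ]

namespace Factor

omit [DecidableEq ι] in
/-- A factor is a smooth function of the state. [folklore] -/
theorem contDiff_val (φ : Factor ι) : ContDiff ℝ ⊤ (fun x : ι → ℝ => φ.val x) := by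
  cases φ with
  | coord c => exact contDiff_apply ℝ ℝ c
  | ext e => exact contDiff_const

/-- The magnitude bound of a factor on the ball of radius `ρ`: `ρ` for a coordinate, `|e|` for an external value.
[folklore] -/
def bnd (ρ : ℝ) : Factor ι → ℝ
  | coord _ => ρ
  | ext e => |e|

omit [Fintype ι] [DecidableEq ι] in
/-- `bnd ≥ 0` for `ρ ≥ 0`. [folklore] -/
theorem bnd_nonneg {ρ : ℝ} (hρ : 0 ≤ ρ) (φ : Factor ι) : 0 ≤ φ.bnd ρ := by
  cases φ with
  | coord _ => exact hρ
  | ext e => exact abs_nonneg e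

omit [DecidableEq ι] in
/-- On the ball `‖x‖ ≤ ρ` a factor is bounded by `bnd`. [folklore] -/
theorem abs_val_le {ρ : ℝ} {x : ι → ℝ} (hx : ‖x‖ ≤ ρ) (φ : Factor ι) : |φ.val x| ≤ φ.bnd ρ := by
  cases φ with
  | coord c => exact ((Real.norm_eq_abs _).symm.le.trans (norm_le_pi_norm x c)).trans hx
  | ext e => exact le_rfl

omit [DecidableEq ι] in
/-- The derivative of a factor has operator norm at most `1`. [folklore] -/
theorem norm_deriv_le (φ : Factor ι) : ‖φ.deriv‖ ≤ 1 := by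
  cases φ with
  | coord c =>
    refine ContinuousLinearMap.opNorm_le_bound _ zero_le_one fun x => ?_
    rw [one_mul]
    exact norm_le_pi_norm x c
  | ext e => simp [deriv]

end Factor

/-- **Term-list fields are smooth.** [folklore] -/
theorem contDiff_termField (T : κ → BTerm ι) : ContDiff ℝ ⊤ (termField T) := by
  refine contDiff_pi' fun i => ?_
  simp only [termField]
  refine ContDiff.sum fun k _ => ?_
  exact (contDiff_const.mul (T k).fa.contDiff_val).mul (T k).fb.contDiff_val

/-- **The derivative bound of a term-list field on the ball of radius `ρ`**:
`Σ_k |coef_k| (bnd fa_k ρ + bnd fb_k ρ)` (a bound of `‖termFieldDeriv T x‖` uniform in the output row, hence of the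
sup-operator norm). [folklore] -/
def derivBound (T : κ → BTerm ι) (ρ : ℝ) : ℝ := ∑ k, |(T k).coef| * ((T k).fa.bnd ρ + (T k).fb.bnd ρ)

omit [Fintype ι] [DecidableEq ι] in
/-- `derivBound ≥ 0` for `ρ ≥ 0`. [folklore] -/
theorem derivBound_nonneg (T : κ → BTerm ι) {ρ : ℝ} (hρ : 0 ≤ ρ) : 0 ≤ derivBound T ρ :=
  Finset.sum_nonneg fun k _ => mul_nonneg (abs_nonneg _)
    (add_nonneg ((T k).fa.bnd_nonneg hρ) ((T k).fb.bnd_nonneg hρ))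

omit [Fintype ι] in
/-- `|coefAt| ≤ |coef|`. [folklore] -/
theorem abs_coefAt_le (τ : BTerm ι) (i : ι) : |τ.coefAt i| ≤ |τ.coef| := by
  unfold BTerm.coefAt; split_ifs <;> simp

/-- **On the ball `‖x‖ ≤ ρ` the derivative of a term-list field has operator norm `≤ derivBound T ρ`.** [folklore] -/
theorem norm_termFieldDeriv_le (T : κ → BTerm ι) {ρ : ℝ} (hρ : 0 ≤ ρ) {x : ι → ℝ} (hx : ‖x‖ ≤ ρ) :
    ‖termFieldDeriv T x‖ ≤ derivBound T ρ := by
  -- each component functional is bounded by `derivBound`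
  have hcomp : ∀ i, ‖termFieldDerivComp T x i‖ ≤ derivBound T ρ := by
    intro i
    rw [termFieldDerivComp, derivBound]
    refine (norm_sum_le _ _).trans (Finset.sum_le_sum fun k _ => ?_)
    rw [norm_smul, Real.norm_eq_abs]
    refine mul_le_mul (abs_coefAt_le (T k) i) ?_ (norm_nonneg _) (abs_nonneg _)
    refine (norm_add_le _ _).trans (add_le_add ?_ ?_)
    · rw [norm_smul, Real.norm_eq_abs]
      calc |(T k).fa.val x| * ‖(T k).fb.deriv‖ ≤ (T k).fa.bnd ρ * 1 :=
            mul_le_mul ((T k).fa.abs_val_le hx) ((T k).fb.norm_deriv_le) (norm_nonneg _) ((T k).fa.bnd_nonneg hρ)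
        _ = (T k).fa.bnd ρ := mul_one _
    · rw [norm_smul, Real.norm_eq_abs]
      calc |(T k).fb.val x| * ‖(T k).fa.deriv‖ ≤ (T k).fb.bnd ρ * 1 :=
            mul_le_mul ((T k).fb.abs_val_le hx) ((T k).fa.norm_deriv_le) (norm_nonneg _) ((T k).fb.bnd_nonneg hρ)
        _ = (T k).fb.bnd ρ := mul_one _
  rw [termFieldDeriv]
  refine ContinuousLinearMap.opNorm_le_bound _ (derivBound_nonneg T hρ) fun v => ?_
  refine (pi_norm_le_iff_of_nonneg (mul_nonneg (derivBound_nonneg T hρ) (norm_nonneg _))).2 fun i => ?_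
  simp only [ContinuousLinearMap.pi_apply]
  exact (ContinuousLinearMap.le_opNorm _ _).trans (mul_le_mul_of_nonneg_right (hcomp i) (norm_nonneg _))

/-- **A term-list field is `derivBound T ρ`-Lipschitz on the ball of radius `ρ`.** [folklore] -/
theorem lipschitzOnWith_termField (T : κ → BTerm ι) {ρ : ℝ} (hρ : 0 ≤ ρ) :
    LipschitzOnWith ⟨derivBound T ρ, derivBound_nonneg T hρ⟩ (termField T) (closedBall 0 ρ) := by
  refine (convex_closedBall (0 : ι → ℝ) ρ).lipschitzOnWith_of_nnnorm_hasFDerivWithin_le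
    (fun x _ => hasFDerivWithinAt_termField T _ x) fun x hx => ?_
  have h := norm_termFieldDeriv_le T hρ (mem_closedBall_zero_iff.1 hx)
  exact_mod_cast h

/-- The `hloc` form: on every ball some Lipschitz constant (for any radius, also negative). [folklore] -/
theorem exists_lipschitzOnWith_termField (T : κ → BTerm ι) (ρ : ℝ) :
    ∃ K : ℝ≥0, LipschitzOnWith K (termField T) (closedBall 0 ρ) := by
  rcases le_or_gt 0 ρ with hρ | hρ
  · exact ⟨_, lipschitzOnWith_termField T hρ⟩
  · refine ⟨0, fun x hx => ?_⟩
    have : x ∈ (∅ : Set (ι → ℝ)) := by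
      rw [← closedBall_eq_empty.2 hρ]; exact hx
    exact absurd this (Set.notMem_empty x)

end DSSOneShift

end Summit.NavierStokesRegularity.NavierStokesRegularity.Theorems
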